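import Mathlib
import HarnessLib
import Summits.HubbardSuperconductivity.HubbardSuperconductivity.Theorems.KLProgrammeKLRegimeEngineV8TwoLegGridSpectatorFamily
import Literature.MathematicalPhysics.QuantumLattice.SectorisedEffectiveActionBoundPlateau
import Literature.MathematicalPhysics.QuantumLattice.GrassmannEffectiveActionRepresentation

/-!
# Route `KLProgramme` — ENGINE child gen 8 (stmt-HubbardSuperconductivity-20437 `KLRegimeEngineV17F2`), class #7 in GRID currency ((Y′)-GRID), deliverable
# W3 «plain-leg m = 2 read-out pass»: RE-SECTORISATION ⊕ IDENTITY — the spectator substitution of the next family is the tower's re-sectorisation on the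
# sector legs and the identity on the spectators (cell gate-hubbard-kl, seat hubbard-kl-k3c2-p3 g7)

The W3 pass (memo W3-DOOR §5) is the tower's induction replayed in the enlarged algebra `Γ_sec ⊕ ρ`: the step of scale `j+1` maps `Ψ^{(F)}_p W_j[K]` to
`Ψ^{(F)}_p W_{j+1}[K]` EXACTLY (`effAction_fromBlocks_map_fromRows`), and between scales the family changes, `F = F_{j+1} ↦ F′ = F_{j+2}`.  Since the tower's
re-sectorisation is the substitution `T = (ε•E(F′))·S(F̃)` (k3c4-p1's `sectorPreimage_map_eq_map_mul`) and `F′` is supported in the plateau of `F`, the spectator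
substitutions of the two families differ by `T` on the sector legs and by NOTHING on the spectators:
`Ψ^{(F′)}_p = map (toLin' (fromBlocks T 0 0 1)) ∘ Ψ^{(F)}_p` — «re-sectorisation ⊕ identity per scale».  With this, every brick of the enlarged tower is a brick
of the tower (Gram / decay / overlap rows of `fromBlocks · 0 0 ·` = those of the sector blocks).

* `fromBlocks_zero_one_mul_fromRows` — `fromBlocks T 0 0 1 · fromRows M B = fromRows (T·M) B`;
* `map_fromBlocks_zero_one_map_fromRows` — `map (toLin' (fromBlocks T 0 0 1)) (map (toLin' (fromRows M B)) W) = map (toLin' (fromRows (T·M) B)) W`;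
* **`resectorisation_mul_spectatorAnalysis`** — `((ε•E(F′))·S(F̃)) · ((ε•E(F))·S_{4M}) = (ε•E(F′))·S_{4M}` (`F̃F = F`, `F′` in the plateau of `F`);
* **`spectatorSubst_resectorisation`** — `Ψ^{(F′)}_p W = map (toLin' (fromBlocks ((ε•E(F′))·S(F̃)) 0 0 1)) (Ψ^{(F)}_p W)` for every grid element `W` and every
  spectator family `p`.

Exact identities; no estimate, no definition; nothing about the model's sizes is asserted; nothing asserts superconductivity.
References: BGM 2006 §2.7 (2.70)–(2.71a), §2.8 (2.82) [cite: BenfattoGiulianiMastropietro2006].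
-/

noncomputable section

namespace Summit.HubbardSuperconductivity.HubbardSuperconductivity.Theorems.EngineV8

set_option linter.dupNamespace false -- summit = problem name (single-conjunct summit), D-0017

open Real Finset Literature.MathematicalPhysics.QuantumLattice Literature.Probability.LatticeModels
open Literature.Probability.LatticeModels.BattleFederbush GrassmannAlgebra
open Summit.HubbardSuperconductivity.HubbardSuperconductivity.Theorems.KLRegimeSplit
open Summit.HubbardSuperconductivity.HubbardSuperconductivity.Theorems.KLProgrammeLegKernels

/-! ## §1 Generic: `fromBlocks T 0 0 1` acts on the substitution rows only -/

section Generic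

variable {R : Type*} [CommRing R] {Γ Γ' Γ'' ρ : Type*} [Fintype Γ] [DecidableEq Γ] [Fintype Γ'] [DecidableEq Γ'] [Fintype Γ''] [DecidableEq Γ'']
  [Fintype ρ] [DecidableEq ρ]

omit [Fintype Γ] [DecidableEq Γ] [DecidableEq Γ'] [Fintype Γ''] [DecidableEq Γ''] in
/-- `fromBlocks T 0 0 1 · fromRows M B = fromRows (T·M) B`. -/
theorem fromBlocks_zero_one_mul_fromRows (T : Matrix Γ'' Γ' R) (M : Matrix Γ' Γ R) (B : Matrix ρ Γ R) :
    Matrix.fromBlocks T (0 : Matrix Γ'' ρ R) (0 : Matrix ρ Γ' R) (1 : Matrix ρ ρ R) * Matrix.fromRows M B = Matrix.fromRows (T * M) B := by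
  rw [Matrix.fromBlocks_mul_fromRows]
  simp

omit [Fintype Γ''] [DecidableEq Γ''] in
/-- **Composing a spectator substitution with `fromBlocks T 0 0 1`** replaces the substitution rows `M` by `T·M` and leaves the spectator rows alone:
`map (toLin' (fromBlocks T 0 0 1)) (map (toLin' (fromRows M B)) W) = map (toLin' (fromRows (T·M) B)) W`. -/
theorem map_fromBlocks_zero_one_map_fromRows [Algebra ℚ R] (T : Matrix Γ'' Γ' R) (M : Matrix Γ' Γ R) (B : Matrix ρ Γ R) (W : GrassmannAlgebra R Γ) :
    ExteriorAlgebra.map (Matrix.toLin' (Matrix.fromBlocks T (0 : Matrix Γ'' ρ R) (0 : Matrix ρ Γ' R) (1 : Matrix ρ ρ R)))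
        (ExteriorAlgebra.map (Matrix.toLin' (Matrix.fromRows M B)) W) =
      ExteriorAlgebra.map (Matrix.toLin' (Matrix.fromRows (T * M) B)) W := by
  rw [map_map_eq_map_comp, ← Matrix.toLin'_mul, fromBlocks_zero_one_mul_fromRows]

end Generic

/-! ## §2 Model: re-sectorisation ⊕ identity -/

section Model

variable {L M : ℕ} [NeZero L] [NeZero M] {N N' : ℕ} {ρ : Type*} [Fintype ρ] [DecidableEq ρ]

omit [Fintype ρ] [DecidableEq ρ] in
/-- **The re-sectorisation matrix composes with the spectator analysis rows** (`F̃F = F`, `F′` supported in the plateau of `F`):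
`((ε•E(F′))·S(F̃)) · ((ε•E(F))·S_{4M}) = (ε•E(F′))·S_{4M}` (`S(F̃)·(ε•E(F)) = diag(Σ_ω F_ω)` and `E(F′)·diag = E(F′)` on the plateau). -/
theorem resectorisation_mul_spectatorAnalysis {β : ℝ} (hβ : β ≠ 0) (F Ft : Fin N → FreqMomentum L M → ℂ) (hFF : ∀ ω k, Ft ω k * F ω k = F ω k)
    (F' : Fin N' → FreqMomentum L M → ℂ) (hF'pl : ∀ (ω' : Fin N') (k : FreqMomentum L M), F' ω' k ≠ 0 → ∑ ω, F ω k = 1) :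
    ((((imagTimeWeight β M : ℝ) : ℂ)) • sectorAnalysisMatrix L M β F' * sectorSubMatrix L M β Ft) *
        ((((imagTimeWeight β M : ℝ) : ℂ)) • sectorAnalysisMatrix L M β F * hubbardGridSub L M β (2 * (2 * M))) =
      (((imagTimeWeight β M : ℝ) : ℂ)) • sectorAnalysisMatrix L M β F' * hubbardGridSub L M β (2 * (2 * M)) := by
  have hdiag := sectorSubMatrix_mul_smul_sectorAnalysisMatrix_of_fat hβ F Ft hFF
  have hplat : sectorAnalysisMatrix L M β F' * Matrix.diagonal (fun K : HubbardFieldIdx L M => ∑ ω, F ω K.1.1) = sectorAnalysisMatrix L M β F' :=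
    sectorAnalysisMatrix_mul_diagonal_of_eq_one β F' _ fun ω' K hK => hF'pl ω' K.1.1 hK
  calc ((((imagTimeWeight β M : ℝ) : ℂ)) • sectorAnalysisMatrix L M β F' * sectorSubMatrix L M β Ft) *
        ((((imagTimeWeight β M : ℝ) : ℂ)) • sectorAnalysisMatrix L M β F * hubbardGridSub L M β (2 * (2 * M)))
      = (((imagTimeWeight β M : ℝ) : ℂ)) • (sectorAnalysisMatrix L M β F' *
          (sectorSubMatrix L M β Ft * ((((imagTimeWeight β M : ℝ) : ℂ)) • sectorAnalysisMatrix L M β F)) * hubbardGridSub L M β (2 * (2 * M))) := by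
        simp only [Matrix.smul_mul, Matrix.mul_smul, Matrix.mul_assoc, smul_smul]
    _ = (((imagTimeWeight β M : ℝ) : ℂ)) • sectorAnalysisMatrix L M β F' * hubbardGridSub L M β (2 * (2 * M)) := by
        rw [hdiag, hplat, Matrix.smul_mul]

/-- **RE-SECTORISATION ⊕ IDENTITY**: for every grid element `W` and every spectator family `p`, the spectator substitution of the next family is the tower's
re-sectorisation `T = (ε•E(F′))·S(F̃)` on the sector legs and the identity on the spectators:
`Ψ^{(F′)}_p W = map (toLin' (fromBlocks T 0 0 1)) (Ψ^{(F)}_p W)`. -/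
theorem spectatorSubst_resectorisation {β : ℝ} (hβ : β ≠ 0) (F Ft : Fin N → FreqMomentum L M → ℂ) (hFF : ∀ ω k, Ft ω k * F ω k = F ω k)
    (F' : Fin N' → FreqMomentum L M → ℂ) (hF'pl : ∀ (ω' : Fin N') (k : FreqMomentum L M), F' ω' k ≠ 0 → ∑ ω, F ω k = 1)
    (p : ρ → GridLeg (GridPoint L (2 * (2 * M)))) (W : GrassmannAlgebra ℂ (GridLeg (GridPoint L (2 * (2 * M))))) :
    ExteriorAlgebra.map (Matrix.toLin' (Matrix.fromRows
        ((((imagTimeWeight β M : ℝ) : ℂ)) • sectorAnalysisMatrix L M β F' * hubbardGridSub L M β (2 * (2 * M)))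
        (Matrix.of fun b q => if p b = q then (1 : ℂ) else 0))) W =
      ExteriorAlgebra.map (Matrix.toLin' (Matrix.fromBlocks
          ((((imagTimeWeight β M : ℝ) : ℂ)) • sectorAnalysisMatrix L M β F' * sectorSubMatrix L M β Ft)
          (0 : Matrix (SpaceTimeIdx L M × SectorLeg N') ρ ℂ) (0 : Matrix ρ (SpaceTimeIdx L M × SectorLeg N) ℂ) (1 : Matrix ρ ρ ℂ)))
        (ExteriorAlgebra.map (Matrix.toLin' (Matrix.fromRows
          ((((imagTimeWeight β M : ℝ) : ℂ)) • sectorAnalysisMatrix L M β F * hubbardGridSub L M β (2 * (2 * M)))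
          (Matrix.of fun b q => if p b = q then (1 : ℂ) else 0))) W) := by
  rw [map_fromBlocks_zero_one_map_fromRows, resectorisation_mul_spectatorAnalysis hβ F Ft hFF F' hF'pl]

end Model

end Summit.HubbardSuperconductivity.HubbardSuperconductivity.Theorems.EngineV8

end
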